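import Summits.Ventures.YMGap.Thresholds.OneLinkEigenModulus
import HarnessLib

/-!
# Venture YMGap — the one-link modulus, refined first order (1/3): Schwinger–Dyson means and fourth moments of linear
# trace observables under the one-link measure `ν_B ∝ exp(N Re tr(gB)) dg` on `SU(N)`

HONEST FRAMING: venture file of the cell `pub-ymgap` (QuantumFields programme), strong-coupling LATTICE bookkeeping; nothing about
the continuum.  Tools for the refinement of `oneLinkKRModulus_eigen` (sibling files `OneLinkEigenRefined`,
`OneLinkEigenRefinedRows`): for the LINEAR trace observables `X = Im tr(Bg) = Re tr(g(−iB))`, `Y = Im tr(Δg)`,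
* `abs_mean_linear_le` — the Schwinger–Dyson bound `|E_ν Re tr(gM)| ≤ (N/(N − 1/N))·2√N·‖B‖_op·‖M‖_F` (from `∫ L_S u dν = 0` and
  `L_S u = −λu + N Γ(Re tr(·B), u)`), hence `|E X| ≤ (N/λ)·2N‖B‖_op²`, `|E Y| ≤ (N/λ)·2√N‖B‖_op‖Δ‖_F`;
* `variance_sq_centered_le` — Poincaré on squares: `Var_ν((f − Ef)²) ≤ 4‖M‖_F²·Var_ν(f)/K_S`, `K_S = N(1/2 − ‖B‖_op)`, for
  `f = Re tr(·M)` (the one-link Poincaré inequality `poincare_pot` in gradient form applied to the smooth square);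
* `trace_trace_sq_moment_le` — `E_ν[(X − EX)²(Y − EY)²] ≤ 5·(N‖B‖_op²/K_S)·(‖Δ‖_F²/K_S)` (the two facts above + Cauchy–Schwarz
  for the covariance of the squares).
All `N ≥ 2`, `‖B‖_op < 1/2`, hypothesis-free.  Cell note `HOME/p2/ONE-LINK-MODULUS.md` §5.
-/

noncomputable section

open scoped Matrix ComplexConjugate BigOperators ContDiff Matrix.Norms.Frobenius
open Matrix Complex Finset MeasureTheory ProbabilityTheory
open Literature.MathematicalPhysics.QuantumFieldTheory
open Literature.MathematicalPhysics.QuantumFieldTheory.SUNBakryEmery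
open Literature.MathematicalPhysics.QuantumFieldTheory.Balaban1983to89.StrongCouplingDobrushinWindow
open Literature.MathematicalPhysics.QuantumFieldTheory.Balaban1983to89.StrongCouplingKernelWindow

namespace Summit.Ventures.YMGap.OneLinkEigen

variable {N : ℕ}

variable {N : ℕ}

/-! ### Pointwise bounds -/

/-- `|Γ(Re tr(·B), Re tr(·M))(g)| ≤ 2√N ‖B‖_op ‖M‖_F` on `SU(N)` (crude; the trace–trace term costs `N·‖B‖_op·√N·‖M‖_F/N`).
[folklore] -/
theorem abs_Gam_pot_one_one_le (hN : N ≠ 0) (B M : Matrix (Fin N) (Fin N) ℂ) (g : SUN N) :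
    |Gam (pot 1 B) (pot 1 M) g| ≤ 2 * Real.sqrt N * matrixOpNorm B * frobNorm M := by
  rw [Gam_pot_pot_su hN, one_mul, one_mul]
  have hN0 : (0 : ℝ) ≤ Real.sqrt N := Real.sqrt_nonneg _
  have hBF : frobNorm B ≤ Real.sqrt N * matrixOpNorm B := frobNorm_le_sqrt_mul_matrixOpNorm B
  have hB0 := matrixOpNorm_nonneg B
  have hM0 := frobNorm_nonneg M
  have h1 : |(B * (g : Matrix (Fin N) (Fin N) ℂ) * M * (g : Matrix (Fin N) (Fin N) ℂ)).trace.re| ≤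
      Real.sqrt N * matrixOpNorm B * frobNorm M := by
    rw [Matrix.mul_assoc (B * (g : Matrix (Fin N) (Fin N) ℂ))]
    refine (abs_re_trace_mul_le _ _).trans ?_
    rw [frobNorm_mul_unitary _ (SUN.mem_unitaryGroup g), frobNorm_mul_unitary _ (SUN.mem_unitaryGroup g)]
    exact mul_le_mul_of_nonneg_right hBF hM0
  have h2 : |(B * Mᴴ).trace.re| ≤ Real.sqrt N * matrixOpNorm B * frobNorm M := by
    refine (abs_re_trace_mul_le _ _).trans ?_
    rw [frobNorm_conjTranspose]
    exact mul_le_mul_of_nonneg_right hBF hM0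
  have h3 : |(B * (g : Matrix (Fin N) (Fin N) ℂ)).trace.im * (M * (g : Matrix (Fin N) (Fin N) ℂ)).trace.im| ≤
      (N * matrixOpNorm B) * (Real.sqrt N * frobNorm M) := by
    rw [abs_mul]
    exact mul_le_mul (abs_im_trace_mul_su_le B g) (abs_im_trace_mul_su_le' M g) (abs_nonneg _) (by positivity)
  have hNpos : (0 : ℝ) < N := Nat.cast_pos.2 (Nat.pos_of_ne_zero hN)
  calc |-(1 / 2) * (B * g * M * g).trace.re + 1 / 2 * (B * Mᴴ).trace.re -
          1 / N * (B * (g : Matrix (Fin N) (Fin N) ℂ)).trace.im * (M * (g : Matrix (Fin N) (Fin N) ℂ)).trace.im|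
      ≤ |-(1 / 2) * (B * g * M * g).trace.re| + |1 / 2 * (B * Mᴴ).trace.re| +
          |1 / N * (B * (g : Matrix (Fin N) (Fin N) ℂ)).trace.im * (M * (g : Matrix (Fin N) (Fin N) ℂ)).trace.im| := by
        refine (abs_sub _ _).trans (add_le_add (abs_add_le _ _) le_rfl)
    _ ≤ 1 / 2 * (Real.sqrt N * matrixOpNorm B * frobNorm M) + 1 / 2 * (Real.sqrt N * matrixOpNorm B * frobNorm M) +
          1 / N * ((N * matrixOpNorm B) * (Real.sqrt N * frobNorm M)) := by
        rw [abs_mul, abs_mul, mul_assoc (1 / (N : ℝ)), abs_mul (1 / (N : ℝ)), abs_neg,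
          abs_of_pos (by norm_num : (0 : ℝ) < 1 / 2), abs_of_pos (by positivity : (0 : ℝ) < 1 / N)]
        exact add_le_add (add_le_add (mul_le_mul_of_nonneg_left h1 (by norm_num))
          (mul_le_mul_of_nonneg_left h2 (by norm_num))) (mul_le_mul_of_nonneg_left h3 (by positivity))
    _ = 2 * Real.sqrt N * matrixOpNorm B * frobNorm M := by field_simp; ring

/-- **The carré du champ of a squared centred linear observable**: for `u = (Re tr(· M) − c)²`,
`Γ(u,u)(Q) = 4 (Re tr(QM) − c)² Γ(Re tr(·M), Re tr(·M))(Q)`. [folklore] -/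
theorem Gam_sq_sub_const (M : Matrix (Fin N) (Fin N) ℂ) (c : ℝ) (Q : Matrix (Fin N) (Fin N) ℂ) :
    Gam (fun Q => (pot 1 M Q - c) ^ 2) (fun Q => (pot 1 M Q - c) ^ 2) Q =
      4 * (pot 1 M Q - c) ^ 2 * Gam (pot 1 M) (pot 1 M) Q := by
  have hp : ContDiff ℝ ∞ (pot (N := N) 1 M) := contDiff_pot 1 M
  have hpc : ContDiff ℝ ∞ (fun Q => pot (N := N) 1 M Q - c) := hp.sub contDiff_const
  have hsq : ContDiff ℝ ∞ (fun x : ℝ => x ^ 2) := contDiff_id.pow 2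
  have hD : ∀ A : Matrix (Fin N) (Fin N) ℂ, matD A (fun Q => (pot 1 M Q - c) ^ 2) =
      fun Q => 2 * (pot 1 M Q - c) * matD A (pot 1 M) Q := by
    intro A
    rw [matD_comp (h := fun x : ℝ => x ^ 2) hpc hsq]
    funext Q
    have hd : deriv (fun x : ℝ => x ^ 2) (pot 1 M Q - c) = 2 * (pot 1 M Q - c) := by
      rw [deriv_pow_field]; ring
    have hsub : matD A (fun Q => pot (N := N) 1 M Q - c) = matD A (pot 1 M) := by
      rw [show (fun Q => pot (N := N) 1 M Q - c) = pot 1 M - fun _ => c from rfl, matD_sub hp contDiff_const,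
        matD_const, sub_zero]
    rw [hd, hsub]
  simp only [Gam, hD]
  rw [Finset.mul_sum]
  refine sum_congr rfl fun α _ => ?_
  ring

/-! ### Schwinger–Dyson means and fourth moments under the one-link measure -/

section Tilted

/-- **Schwinger–Dyson bound on the mean of a linear observable**: under `ν_B ∝ exp(N Re tr(gB)) dg`,
`|E_ν Re tr(gM)| ≤ (N/(N − 1/N)) · 2√N ‖B‖_op ‖M‖_F` — from `∫ L_S u dν = 0` with `L_S u = −λu + N Γ(Re tr(·B), u)`.
[folklore] -/
theorem abs_mean_linear_le (hN : 2 ≤ N) (B M : Matrix (Fin N) (Fin N) ℂ) :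
    |∫ g, ((g : Matrix (Fin N) (Fin N) ℂ) * M).trace.re
        ∂(haarProbability (SUN N)).tilted (fun g => (N : ℝ) * ((g : Matrix (Fin N) (Fin N) ℂ) * B).trace.re)| ≤
      (N : ℝ) / ((N : ℝ) - 1 / N) * (2 * Real.sqrt N * matrixOpNorm B * frobNorm M) := by
  have hN0 : N ≠ 0 := by omega
  have hNpos : (0 : ℝ) < N := Nat.cast_pos.2 (Nat.pos_of_ne_zero hN0)
  have hN2 : (2 : ℝ) ≤ N := by exact_mod_cast hN
  set lam : ℝ := (N : ℝ) - 1 / N with hlam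
  have hlampos : 0 < lam := by
    have : (1 : ℝ) / N ≤ 1 / 2 := by rw [div_le_div_iff₀ hNpos (by norm_num)]; linarith
    rw [hlam]; linarith
  set S : Matrix (Fin N) (Fin N) ℂ → ℝ := pot (N : ℝ) B with hSdef
  set u : Matrix (Fin N) (Fin N) ℂ → ℝ := pot 1 M with hudef
  have hS : ContDiff ℝ ∞ S := contDiff_pot _ B
  have hu : ContDiff ℝ ∞ u := contDiff_pot _ M
  set ν : Measure (SUN N) :=
    (haarProbability (SUN N)).tilted (fun g => (N : ℝ) * ((g : Matrix (Fin N) (Fin N) ℂ) * B).trace.re) with hν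
  have hexpc : Continuous fun g : SUN N => Real.exp (S g) := Real.continuous_exp.comp (continuous_restrict hS)
  have hexpi : Integrable (fun g : SUN N => Real.exp ((N : ℝ) * ((g : Matrix (Fin N) (Fin N) ℂ) * B).trace.re))
      (haarProbability (SUN N)) := integrable_of_continuous_SUN hexpc _
  haveI : IsProbabilityMeasure ν := isProbabilityMeasure_tilted hexpi
  set Z : ℝ := ∫ g : SUN N, Real.exp (S g) ∂(haarSU N) with hZ
  have hZpos : 0 < Z := integral_exp_pos (integrable_of_continuous_SUN hexpc _)
  have htilt : ∀ f : SUN N → ℝ, ∫ g, f g ∂ν = (∫ g : SUN N, Real.exp (S g) * f g ∂(haarSU N)) / Z := fun f => by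
    rw [hν]; exact integral_tilted_eq_div _ f
  -- the Schwinger–Dyson identity `λ E u = N E Γ(pot 1 B, u)`
  have hgen : ∀ g : SUN N, genL S u g = -(lam * u g) + (N : ℝ) * Gam (pot 1 B) (pot 1 M) g := by
    intro g
    have hL := congrFun (Lap_pot hN0 1 M) (g : Matrix (Fin N) (Fin N) ℂ)
    have hG : Gam S (pot 1 M) g = (N : ℝ) * Gam (pot 1 B) (pot 1 M) g := by
      rw [hSdef, Gam_pot_pot hN0, Gam_pot_pot hN0]; ring
    show Lap u g + Gam S u g = _
    rw [hudef, hL, hG, hlam]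
  have hint0 : ∫ g, genL S u g ∂ν = 0 := by
    rw [htilt, integral_exp_mul_genL_eq_zero hN0 hS hu, zero_div]
  have huc : Continuous fun g : SUN N => u g := continuous_restrict hu
  have hGc : Continuous fun g : SUN N => Gam (pot 1 B) (pot 1 M) g :=
    continuous_restrict (contDiff_Gam (contDiff_pot 1 B) (contDiff_pot 1 M))
  have hui : Integrable (fun g : SUN N => u g) ν := integrable_of_continuous_SUN huc _
  have hGi : Integrable (fun g : SUN N => Gam (pot 1 B) (pot 1 M) g) ν := integrable_of_continuous_SUN hGc _
  have hid : lam * ∫ g, u g ∂ν = (N : ℝ) * ∫ g, Gam (pot 1 B) (pot 1 M) g ∂ν := by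
    have h := hint0
    simp_rw [hgen] at h
    have i1 : Integrable (fun g : SUN N => -(lam * u g)) ν := (hui.const_mul lam).neg
    have i2 : Integrable (fun g : SUN N => (N : ℝ) * Gam (pot 1 B) (pot 1 M) g) ν := hGi.const_mul _
    rw [integral_add i1 i2, integral_neg, integral_const_mul, integral_const_mul] at h
    linarith
  have hmeanG : |∫ g, Gam (pot 1 B) (pot 1 M) g ∂ν| ≤ 2 * Real.sqrt N * matrixOpNorm B * frobNorm M := by
    refine (abs_integral_le_integral_abs).trans ?_
    calc ∫ g, |Gam (pot 1 B) (pot 1 M) g| ∂ν ≤ ∫ g, (2 * Real.sqrt N * matrixOpNorm B * frobNorm M) ∂ν :=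
          integral_mono hGi.abs (integrable_const _) fun g => abs_Gam_pot_one_one_le hN0 B M g
      _ = 2 * Real.sqrt N * matrixOpNorm B * frobNorm M := by simp
  have hueq : ∀ g : SUN N, ((g : Matrix (Fin N) (Fin N) ℂ) * M).trace.re = u g := fun g => by
    simp only [hudef, pot, one_mul]
  simp_rw [hueq]
  have : ∫ g, u g ∂ν = (N : ℝ) / lam * ∫ g, Gam (pot 1 B) (pot 1 M) g ∂ν := by
    rw [div_mul_eq_mul_div, eq_div_iff hlampos.ne']; linarith
  rw [this, abs_mul, abs_of_pos (div_pos hNpos hlampos)]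
  exact mul_le_mul_of_nonneg_left hmeanG (div_pos hNpos hlampos).le

/-- **Poincaré on squares**: for the linear observable `f = Re tr(· M)` and its `ν_B`-mean `c`,
`Var_ν((f − c)²) ≤ 4 ‖M‖_F² · Var_ν(f) / (N (1/2 − ‖B‖_op))` (the gradient-form one-link Poincaré inequality `poincare_pot` applied
to the smooth square, `Γ((f−c)², (f−c)²) = 4(f−c)² Γ(f,f) ≤ 4‖M‖_F² (f−c)²`). [folklore] -/
theorem variance_sq_centered_le (hN : 2 ≤ N) {B : Matrix (Fin N) (Fin N) ℂ} (hB : matrixOpNorm B < 1 / 2)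
    (M : Matrix (Fin N) (Fin N) ℂ) :
    Var[fun g : SUN N => (((g : Matrix (Fin N) (Fin N) ℂ) * M).trace.re -
        ∫ s, ((s : Matrix (Fin N) (Fin N) ℂ) * M).trace.re
          ∂(haarProbability (SUN N)).tilted (fun g => (N : ℝ) * ((g : Matrix (Fin N) (Fin N) ℂ) * B).trace.re)) ^ 2;
      (haarProbability (SUN N)).tilted (fun g => (N : ℝ) * ((g : Matrix (Fin N) (Fin N) ℂ) * B).trace.re)] ≤
      4 * frobNorm M ^ 2 * Var[fun g : SUN N => ((g : Matrix (Fin N) (Fin N) ℂ) * M).trace.re;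
        (haarProbability (SUN N)).tilted (fun g => (N : ℝ) * ((g : Matrix (Fin N) (Fin N) ℂ) * B).trace.re)] /
        ((N : ℝ) * (1 / 2 - matrixOpNorm B)) := by
  have hN0 : N ≠ 0 := by omega
  have hNpos : (0 : ℝ) < N := Nat.cast_pos.2 (Nat.pos_of_ne_zero hN0)
  set S : Matrix (Fin N) (Fin N) ℂ → ℝ := pot (N : ℝ) B with hSdef
  have hS : ContDiff ℝ ∞ S := contDiff_pot _ B
  set ν : Measure (SUN N) :=
    (haarProbability (SUN N)).tilted (fun g => (N : ℝ) * ((g : Matrix (Fin N) (Fin N) ℂ) * B).trace.re) with hν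
  have hexpc : Continuous fun g : SUN N => Real.exp (S g) := Real.continuous_exp.comp (continuous_restrict hS)
  have hexpi : Integrable (fun g : SUN N => Real.exp ((N : ℝ) * ((g : Matrix (Fin N) (Fin N) ℂ) * B).trace.re))
      (haarProbability (SUN N)) := integrable_of_continuous_SUN hexpc _
  haveI : IsProbabilityMeasure ν := isProbabilityMeasure_tilted hexpi
  set Z : ℝ := ∫ g : SUN N, Real.exp (S g) ∂(haarSU N) with hZ
  have hZpos : 0 < Z := integral_exp_pos (integrable_of_continuous_SUN hexpc _)
  have htilt : ∀ f : SUN N → ℝ, ∫ g, f g ∂ν = (∫ g : SUN N, Real.exp (S g) * f g ∂(haarSU N)) / Z := fun f => by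
    rw [hν]; exact integral_tilted_eq_div _ f
  set K : ℝ := (N : ℝ) * (1 / 2 - matrixOpNorm B) with hK
  have hKpos : 0 < K := mul_pos hNpos (by linarith)
  have hKeq : (N : ℝ) / 2 - |(N : ℝ)| * matrixOpNorm B = K := by rw [abs_of_pos hNpos, hK]; ring
  have hK' : 0 < (N : ℝ) / 2 - |(N : ℝ)| * matrixOpNorm B := by rwa [hKeq]
  -- the observable and its square
  set f : SUN N → ℝ := fun g => ((g : Matrix (Fin N) (Fin N) ℂ) * M).trace.re with hf
  set c : ℝ := ∫ s, f s ∂ν with hc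
  set u : Matrix (Fin N) (Fin N) ℂ → ℝ := fun Q => (pot 1 M Q - c) ^ 2 with hudef
  have hu : ContDiff ℝ ∞ u := ((contDiff_pot 1 M).sub contDiff_const).pow 2
  have hfu : ∀ g : SUN N, (f g - c) ^ 2 = u g := fun g => by simp only [hudef, hf, pot, one_mul]
  have hfc : Continuous f := continuous_re_trace_su_mul M
  have huc : Continuous fun g : SUN N => u g := continuous_restrict hu
  -- variances as weighted integrals
  set mu : ℝ := (∫ g : SUN N, Real.exp (S g) * u g ∂(haarSU N)) / Z with hmu
  have hmean_u : ∫ g, u g ∂ν = mu := by rw [htilt]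
  have hvar_u : Var[fun g : SUN N => (f g - c) ^ 2; ν] =
      (∫ g : SUN N, Real.exp (S g) * (u g - mu) ^ 2 ∂(haarSU N)) / Z := by
    simp_rw [hfu]
    rw [ProbabilityTheory.variance_eq_integral huc.aemeasurable, hmean_u, htilt]
  have hvar_f : Var[f; ν] = (∫ g : SUN N, Real.exp (S g) * (f g - c) ^ 2 ∂(haarSU N)) / Z := by
    rw [ProbabilityTheory.variance_eq_integral hfc.aemeasurable, ← hc, htilt]
  -- Poincaré for `u`, gradient form, and the bound on `Γ(u,u)`
  have hP := poincare_pot hN0 (N : ℝ) B hK' hu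
  rw [hKeq] at hP
  have hΓ : ∀ g : SUN N, Gam u u g ≤ 4 * frobNorm M ^ 2 * (f g - c) ^ 2 := by
    intro g
    rw [hudef, Gam_sq_sub_const]
    have h1 := Gam_pot_one_self_le hN0 M g
    have h2 : 0 ≤ (pot 1 M (g : Matrix (Fin N) (Fin N) ℂ) - c) ^ 2 := sq_nonneg _
    have h3 : pot 1 M (g : Matrix (Fin N) (Fin N) ℂ) = f g := by simp only [hf, pot, one_mul]
    rw [h3]
    nlinarith [Gam_self_nonneg (pot 1 M) (g : Matrix (Fin N) (Fin N) ℂ)]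
  have hwint : ∀ {φ : SUN N → ℝ}, Continuous φ → Integrable (fun g : SUN N => Real.exp (S g) * φ g) (haarSU N) :=
    fun hφ => integrable_of_continuous_SUN (hexpc.mul hφ) _
  -- `m_u` is the weighted mean, so the Poincaré left side is `Z · Var(u)` with the SAME centring
  have hmu_eq : (∫ g : SUN N, Real.exp (pot (N : ℝ) B g) * u g ∂(haarSU N)) /
      (∫ g : SUN N, Real.exp (pot (N : ℝ) B g) ∂(haarSU N)) = mu := by rw [hmu, hZ]
  rw [hmu_eq] at hP
  have hchain : K * ∫ g : SUN N, Real.exp (S g) * (u g - mu) ^ 2 ∂(haarSU N) ≤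
      4 * frobNorm M ^ 2 * ∫ g : SUN N, Real.exp (S g) * (f g - c) ^ 2 ∂(haarSU N) := by
    refine hP.trans ?_
    rw [← integral_const_mul]
    refine integral_mono (hwint (continuous_restrict (contDiff_Gam hu hu))) ?_ fun g => ?_
    · exact (hwint ((hfc.sub continuous_const).pow 2)).const_mul _
    · have := mul_le_mul_of_nonneg_left (hΓ g) (Real.exp_pos (S g)).le
      calc Real.exp (S g) * Gam u u g ≤ Real.exp (S g) * (4 * frobNorm M ^ 2 * (f g - c) ^ 2) := this
        _ = 4 * frobNorm M ^ 2 * (Real.exp (S g) * (f g - c) ^ 2) := by ring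
  rw [hvar_u, hvar_f, le_div_iff₀ hKpos]
  have e1 : (∫ g : SUN N, Real.exp (S g) * (u g - mu) ^ 2 ∂(haarSU N)) / Z * K =
      (K * ∫ g : SUN N, Real.exp (S g) * (u g - mu) ^ 2 ∂(haarSU N)) / Z := by ring
  have e2 : 4 * frobNorm M ^ 2 * ((∫ g : SUN N, Real.exp (S g) * (f g - c) ^ 2 ∂(haarSU N)) / Z) =
      (4 * frobNorm M ^ 2 * ∫ g : SUN N, Real.exp (S g) * (f g - c) ^ 2 ∂(haarSU N)) / Z := by ring
  rw [e1, e2]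
  exact div_le_div_of_nonneg_right hchain hZpos.le

/-- Means, variances: the linear observables `X = Im tr(Bg) = Re tr(g(−iB))`, `Y = Im tr(Δg) = Re tr(g(−iΔ))`. [folklore] -/
theorem im_trace_mul_su_eq (B : Matrix (Fin N) (Fin N) ℂ) (g : SUN N) :
    (B * (g : Matrix (Fin N) (Fin N) ℂ)).trace.im = ((g : Matrix (Fin N) (Fin N) ℂ) * ((-I) • B)).trace.re := by
  rw [Matrix.mul_smul, trace_smul, trace_mul_comm, smul_eq_mul, mul_re, neg_re, neg_im, I_re, I_im]
  ring

/-- `‖−i B‖_F = ‖B‖_F`. [folklore] -/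
theorem frobNorm_neg_I_smul (B : Matrix (Fin N) (Fin N) ℂ) : frobNorm ((-I) • B) = frobNorm B := by
  rw [frobNorm_smul, norm_neg, norm_I, one_mul]

/-- **Fourth moments of the trace–trace term**: with `X = Im tr(Bg)`, `Y = Im tr(Δg)` and their `ν_B`-means,
`E_ν[(X − EX)²(Y − EY)²] ≤ 5 · (N‖B‖_op²/K) · (‖Δ‖_F²/K)`, `K = N(1/2 − ‖B‖_op)` (Poincaré for `X`, `Y`, Poincaré on the squares,
Cauchy–Schwarz for the covariance of the squares). [folklore] -/
theorem trace_trace_sq_moment_le (hN : 2 ≤ N) {B : Matrix (Fin N) (Fin N) ℂ} (hB : matrixOpNorm B < 1 / 2)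
    (Δ : Matrix (Fin N) (Fin N) ℂ) :
    ∫ g, ((B * (g : Matrix (Fin N) (Fin N) ℂ)).trace.im -
          ∫ s, (B * (s : Matrix (Fin N) (Fin N) ℂ)).trace.im
            ∂(haarProbability (SUN N)).tilted (fun g => (N : ℝ) * ((g : Matrix (Fin N) (Fin N) ℂ) * B).trace.re)) ^ 2 *
        ((Δ * (g : Matrix (Fin N) (Fin N) ℂ)).trace.im -
          ∫ s, (Δ * (s : Matrix (Fin N) (Fin N) ℂ)).trace.im
            ∂(haarProbability (SUN N)).tilted (fun g => (N : ℝ) * ((g : Matrix (Fin N) (Fin N) ℂ) * B).trace.re)) ^ 2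
      ∂(haarProbability (SUN N)).tilted (fun g => (N : ℝ) * ((g : Matrix (Fin N) (Fin N) ℂ) * B).trace.re) ≤
      5 * ((Real.sqrt N * matrixOpNorm B) ^ 2 / ((N : ℝ) * (1 / 2 - matrixOpNorm B))) *
        (frobNorm Δ ^ 2 / ((N : ℝ) * (1 / 2 - matrixOpNorm B))) := by
  have hN0 : N ≠ 0 := by omega
  have hNpos : (0 : ℝ) < N := Nat.cast_pos.2 (Nat.pos_of_ne_zero hN0)
  set r : ℝ := matrixOpNorm B with hrdef
  have hr0 : 0 ≤ r := matrixOpNorm_nonneg B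
  have hrpos : 0 < 1 / 2 - r := by linarith
  have hΔ0 : 0 ≤ frobNorm Δ := frobNorm_nonneg Δ
  set K : ℝ := (N : ℝ) * (1 / 2 - r) with hKdef
  have hKpos : 0 < K := mul_pos hNpos hrpos
  set ν : Measure (SUN N) :=
    (haarProbability (SUN N)).tilted (fun g => (N : ℝ) * ((g : Matrix (Fin N) (Fin N) ℂ) * B).trace.re) with hν
  have hexpc : Continuous fun g : SUN N => Real.exp (pot (N : ℝ) B g) :=
    Real.continuous_exp.comp (continuous_restrict (contDiff_pot _ B))
  have hexpi : Integrable (fun g : SUN N => Real.exp ((N : ℝ) * ((g : Matrix (Fin N) (Fin N) ℂ) * B).trace.re))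
      (haarProbability (SUN N)) := integrable_of_continuous_SUN hexpc _
  haveI : IsProbabilityMeasure ν := isProbabilityMeasure_tilted hexpi
  set X : SUN N → ℝ := fun g => (B * (g : Matrix (Fin N) (Fin N) ℂ)).trace.im with hX
  set Y : SUN N → ℝ := fun g => (Δ * (g : Matrix (Fin N) (Fin N) ℂ)).trace.im with hY
  set EX : ℝ := ∫ g, X g ∂ν with hEX
  set EY : ℝ := ∫ g, Y g ∂ν with hEY
  show ∫ g, (X g - EX) ^ 2 * (Y g - EY) ^ 2 ∂ν ≤ 5 * ((Real.sqrt N * r) ^ 2 / K) * (frobNorm Δ ^ 2 / K)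
  have hXeq : ∀ g : SUN N, X g = ((g : Matrix (Fin N) (Fin N) ℂ) * ((-I) • B)).trace.re := fun g => im_trace_mul_su_eq B g
  have hYeq : ∀ g : SUN N, Y g = ((g : Matrix (Fin N) (Fin N) ℂ) * ((-I) • Δ)).trace.re := fun g => im_trace_mul_su_eq Δ g
  have hXc' : Continuous X := by
    have : X = fun g : SUN N => ((g : Matrix (Fin N) (Fin N) ℂ) * ((-I) • B)).trace.re := funext hXeq
    rw [this]; exact continuous_re_trace_su_mul _
  have hYc' : Continuous Y := by
    have : Y = fun g : SUN N => ((g : Matrix (Fin N) (Fin N) ℂ) * ((-I) • Δ)).trace.re := funext hYeq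
    rw [this]; exact continuous_re_trace_su_mul _
  have mXc2 : MemLp (fun g => (X g - EX) ^ 2) 2 ν := memLp_two_of_continuous ((hXc'.sub continuous_const).pow 2) ν
  have mYc2 : MemLp (fun g => (Y g - EY) ^ 2) 2 ν := memLp_two_of_continuous ((hYc'.sub continuous_const).pow 2) ν
  -- Lipschitz constants and Poincaré
  have hXL : ∀ x y : SUN N, |X x - X y| ≤ Real.sqrt N * r * suFrobDist x y := by
    intro x y
    rw [hXeq, hXeq]
    refine (abs_re_trace_su_mul_sub_le x y _).trans ?_
    rw [frobNorm_neg_I_smul, mul_comm]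
    exact mul_le_mul_of_nonneg_right (frobNorm_le_sqrt_mul_matrixOpNorm B) (suFrobDist_nonneg _ _)
  have hYL : ∀ x y : SUN N, |Y x - Y y| ≤ frobNorm Δ * suFrobDist x y := by
    intro x y
    rw [hYeq, hYeq]
    refine (abs_re_trace_su_mul_sub_le x y _).trans ?_
    rw [frobNorm_neg_I_smul, mul_comm]
  have hvarX : Var[X; ν] ≤ (Real.sqrt N * r) ^ 2 / K := haarPoincare_SU hN B hB X _ (by positivity) hXL
  have hvarY : Var[Y; ν] ≤ frobNorm Δ ^ 2 / K := haarPoincare_SU hN B hB Y _ hΔ0 hYL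
  have hvarXc2 : Var[fun g => (X g - EX) ^ 2; ν] ≤ 4 * frobNorm B ^ 2 * Var[X; ν] / K := by
    have h := variance_sq_centered_le hN hB ((-I) • B)
    simp only [← hXeq] at h
    rw [← hν] at h
    have e1 : (fun g : SUN N => X g) = X := rfl
    simp only [e1] at h
    rw [← hEX, ← hrdef, ← hKdef, frobNorm_neg_I_smul] at h
    exact h
  have hvarYc2 : Var[fun g => (Y g - EY) ^ 2; ν] ≤ 4 * frobNorm Δ ^ 2 * Var[Y; ν] / K := by
    have h := variance_sq_centered_le hN hB ((-I) • Δ)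
    simp only [← hYeq] at h
    rw [← hν] at h
    have e1 : (fun g : SUN N => Y g) = Y := rfl
    simp only [e1] at h
    rw [← hEY, ← hrdef, ← hKdef, frobNorm_neg_I_smul] at h
    exact h
  have hintXc2 : ∫ g, (X g - EX) ^ 2 ∂ν = Var[X; ν] := by
    rw [ProbabilityTheory.variance_eq_integral hXc'.aemeasurable]
  have hintYc2 : ∫ g, (Y g - EY) ^ 2 ∂ν = Var[Y; ν] := by
    rw [ProbabilityTheory.variance_eq_integral hYc'.aemeasurable]
  -- opaque abbreviations for the two variances
  obtain ⟨VX, hVX⟩ : ∃ v : ℝ, Var[X; ν] = v := ⟨_, rfl⟩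
  obtain ⟨VY, hVY⟩ : ∃ v : ℝ, Var[Y; ν] = v := ⟨_, rfl⟩
  have hVX0 : 0 ≤ VX := hVX ▸ variance_nonneg _ _
  have hVY0 : 0 ≤ VY := hVY ▸ variance_nonneg _ _
  rw [hVX] at hvarX hvarXc2 hintXc2
  rw [hVY] at hvarY hvarYc2 hintYc2
  have hBF : frobNorm B ≤ Real.sqrt N * r := frobNorm_le_sqrt_mul_matrixOpNorm B
  have hB0 : 0 ≤ frobNorm B := frobNorm_nonneg B
  have s3 : Real.sqrt (VX / K) ≤ Real.sqrt N * r / K := by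
    have h1 : VX / K ≤ (Real.sqrt N * r) ^ 2 / K / K := div_le_div_of_nonneg_right hvarX hKpos.le
    have e : (Real.sqrt N * r) ^ 2 / K / K = (Real.sqrt N * r / K) ^ 2 := by rw [div_div, div_pow, pow_two K]
    calc Real.sqrt (VX / K) ≤ Real.sqrt ((Real.sqrt N * r / K) ^ 2) := Real.sqrt_le_sqrt (h1.trans_eq e)
      _ = Real.sqrt N * r / K := Real.sqrt_sq (by positivity)
  have s4 : Real.sqrt (VY / K) ≤ frobNorm Δ / K := by
    have h1 : VY / K ≤ frobNorm Δ ^ 2 / K / K := div_le_div_of_nonneg_right hvarY hKpos.le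
    have e : frobNorm Δ ^ 2 / K / K = (frobNorm Δ / K) ^ 2 := by rw [div_div, div_pow, pow_two K]
    calc Real.sqrt (VY / K) ≤ Real.sqrt ((frobNorm Δ / K) ^ 2) := Real.sqrt_le_sqrt (h1.trans_eq e)
      _ = frobNorm Δ / K := Real.sqrt_sq (by positivity)
  -- `E[Xc² Yc²] = cov(Xc², Yc²) + E Xc² · E Yc²`
  have hsub := covariance_eq_sub mXc2 mYc2
  have e2 : ∫ g, (X g - EX) ^ 2 * (Y g - EY) ^ 2 ∂ν = cov[fun g => (X g - EX) ^ 2, fun g => (Y g - EY) ^ 2; ν] +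
      (∫ g, (X g - EX) ^ 2 ∂ν) * ∫ g, (Y g - EY) ^ 2 ∂ν := by rw [hsub]; simp only [Pi.mul_apply]; ring
  rw [e2, hintXc2, hintYc2]
  have hb1 : 0 ≤ 4 * frobNorm B ^ 2 * VX / K := div_nonneg (by positivity) hKpos.le
  have hcs2 : |cov[fun g => (X g - EX) ^ 2, fun g => (Y g - EY) ^ 2; ν]| ≤
      Real.sqrt (Var[fun g => (X g - EX) ^ 2; ν] * Var[fun g => (Y g - EY) ^ 2; ν]) := by
    rw [← Real.sqrt_sq_eq_abs]; exact Real.sqrt_le_sqrt (cov_sq_le_var_mul_var mXc2 mYc2)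
  have hcovsq : |cov[fun g => (X g - EX) ^ 2, fun g => (Y g - EY) ^ 2; ν]| ≤
      Real.sqrt (4 * frobNorm B ^ 2 * VX / K) * Real.sqrt (4 * frobNorm Δ ^ 2 * VY / K) := by
    refine hcs2.trans ?_
    rw [← Real.sqrt_mul hb1]
    exact Real.sqrt_le_sqrt (mul_le_mul hvarXc2 hvarYc2 (variance_nonneg _ _) hb1)
  have h2B : (0 : ℝ) ≤ 2 * frobNorm B := by positivity
  have h2D : (0 : ℝ) ≤ 2 * frobNorm Δ := by positivity
  have h2r : (0 : ℝ) ≤ 2 * (Real.sqrt N * r) := by positivity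
  have hBr : 2 * frobNorm B ≤ 2 * (Real.sqrt N * r) := by linarith
  have s1 : Real.sqrt (4 * frobNorm B ^ 2 * VX / K) ≤ 2 * (Real.sqrt N * r) * (Real.sqrt N * r / K) := by
    have e3 : 4 * frobNorm B ^ 2 * VX / K = (2 * frobNorm B) ^ 2 * (VX / K) := by ring
    rw [e3, Real.sqrt_mul (sq_nonneg (2 * frobNorm B)) (VX / K), Real.sqrt_sq h2B]
    exact mul_le_mul hBr s3 (Real.sqrt_nonneg _) h2r
  have s2 : Real.sqrt (4 * frobNorm Δ ^ 2 * VY / K) ≤ 2 * frobNorm Δ * (frobNorm Δ / K) := by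
    have e3 : 4 * frobNorm Δ ^ 2 * VY / K = (2 * frobNorm Δ) ^ 2 * (VY / K) := by ring
    rw [e3, Real.sqrt_mul (sq_nonneg (2 * frobNorm Δ)) (VY / K), Real.sqrt_sq h2D]
    exact mul_le_mul_of_nonneg_left s4 h2D
  have hcov4 : |cov[fun g => (X g - EX) ^ 2, fun g => (Y g - EY) ^ 2; ν]| ≤
      4 * ((Real.sqrt N * r) ^ 2 / K) * (frobNorm Δ ^ 2 / K) := by
    refine hcovsq.trans ?_
    calc Real.sqrt (4 * frobNorm B ^ 2 * VX / K) * Real.sqrt (4 * frobNorm Δ ^ 2 * VY / K)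
        ≤ (2 * (Real.sqrt N * r) * (Real.sqrt N * r / K)) * (2 * frobNorm Δ * (frobNorm Δ / K)) :=
          mul_le_mul s1 s2 (Real.sqrt_nonneg _) (mul_nonneg h2r (div_nonneg (by positivity) hKpos.le))
      _ = 4 * ((Real.sqrt N * r) ^ 2 / K) * (frobNorm Δ ^ 2 / K) := by ring
  have hprod : VX * VY ≤ ((Real.sqrt N * r) ^ 2 / K) * (frobNorm Δ ^ 2 / K) :=
    mul_le_mul hvarX hvarY hVY0 (div_nonneg (sq_nonneg _) hKpos.le)
  have := abs_le.1 hcov4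
  linarith [this.2]

end Tilted

end Summit.Ventures.YMGap.OneLinkEigen
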